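import Summits.QuantumFields.BalabanUV.Beta.FP.NestedDressingHessian

/-!
# `BalabanUV.Beta.FP.EffectiveFormJets` — road «FP» for binder row D1, RULING R-FP-45 (B) row **SDF-EXACT-2 «THE COARSE TABLES»** (owner, gen 15):
# THE JETS OF THE THREE BLOCKS OF THE BORDERED INVERSE ALONG A FORM CURVE WITH STATIC CONSTRAINTS —
# `Γ̇ = −ΓK̇Γ`, `𝓘̇ = −ΓK̇𝓘`, `𝓘̇ᴸ = −𝓘ᴸK̇Γ`, **`𝔊̇ = 𝓘ᴸK̇𝓘`** (envelope: the first jet of the effective form is the minimiser sandwich) and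
# **`𝔊̈ = 𝓘ᴸK̈𝓘 − 𝓘ᴸK̇ΓK̇𝓘 − 𝓘ᴸK̇ΓK̇𝓘`** (the second jet carries the fluctuation RESPONSE word twice) — and the nested step law's second variation with the
# block curve made EXPLICIT (`secondVar_nestedStepLaw_explicit`): the COARSE TABLES of the exact step law, by a theorem

HONEST DEPENDENCY (page 1, mandatory): continuum YM on T⁴ ⇐ BetaPertH ∧ nine spine estimates (0/9 proved); BetaPertH ⇐ (D1) ∧ (D4) ∧ CAP+tail;
G-an2-4 gates asym, D1 and NE2/3/4.  HONEST FRAMING (cell contract, verbatim): «discharging `BetaPertH` makes Bałaban's UV stability UNCONDITIONAL —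
a real constructive-QFT result; it is NOT the continuum limit and NOT the Clay problem.»  THIS MODULE DISCHARGES NOTHING of the wall: it is [folklore]
one-variable calculus of the inverse of a bordered matrix (road BF-x's `D1BFx.LogDetSecondVariation.hasDerivAt_inv_entry`, `D1BFx.SliceTransferModel.hasDerivAt_kkt`
∕ `hasDerivAt_matMul`) read through the three named blocks of `Beta.CompositionSingular` (`flucCov`, `minOp`, `minOpL`, `effForm`, `kktInv_eq_fromBlocks`),
composed BY NAME with the owner's `NestedDressingHessian.secondVar_nestedStepLaw` (p293881).  No `def`, no `def … : Prop`, nothing cited, 0 sorry; 0∕4 row-D1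
binders; NOT SDF for the literal's perfect objects (kernel-level rows (β)∕(J-S)∕(J-W)∕N-kill∕N-fine∕N-desc of memo `HOME/b2b-balaban-beta-d1-p3/N2B-DESIGN.md` §9 (9f)),
NOT D1, NOT BetaPertH, NOT continuum, NOT Clay.  «not in print; our bookkeeping».

ABSOLUTE RULE (cell charter, verbatim): «No internally-minted statement may enter as a cited fact. Every hypothesis is either kernel-proved in this package or a
verbatim quotation of a PUBLISHED theorem with page reference. The manuscript(s) under audit are NOT citable for their own disputed steps — they are the thing
under adjudication; programme-internal (2001/route/tribunal) claims are never citable.»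

WHY (Q-FP-15-1, journal l.34163; memo §9 (9f) rows (J-S)∕(J-W)).  `NestedDressingHessian.hessWords_nestedStepLaw` is the model of `TP (m+1) = RP m + TP m` with the
block curve `E` DISPLAYED (any `C²` curve agreeing with the effective block form).  For the kernel-level instance the road must know WHICH coarse stencil ∕
second-order table the block step reads: the first and second jets of `u ↦ effForm (K(u)) C` for a form curve `K` with static constraints `C`.  They are
computed here from the derivative of the bordered inverse, `(𝕂⁻¹)˙ = −𝕂⁻¹𝕂̇𝕂⁻¹` with `𝕂̇ = kkt K̇ 0`, block by block (`kktInv_mul_kktZero_mul_kktInv`):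
the effective form's first jet is the MINIMISER SANDWICH `𝓘ᴸK̇𝓘` (the envelope theorem — no response term at first order) and its second jet is
`𝓘ᴸK̈𝓘 − 2·𝓘ᴸK̇ΓK̇𝓘` (the fluctuation response of the fine minimiser, an2's `dM (K2OfK …)` summand one level down).  Read at the perfect objects these are the
targets the m-fold composite tables of the nested (j, m)-families must meet for the kernel-level step law.

CONTENTS ([folklore]; `K : ℝ → ν → ν → ℝ` a form curve, `C : Matrix μ ν ℝ` static constraints, `𝕂(u) = kkt K(u) C`, blocks `Γ = flucCov`, `𝓘 = minOp`,
`𝓘ᴸ = minOpL`, `𝔊 = effForm` of `(K(t), C)`):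
* §1 `kktInv_mul_kktZero_mul_kktInv` — `𝕂⁻¹·kkt K̇ 0·𝕂⁻¹ = [[ΓK̇Γ, ΓK̇𝓘],[𝓘ᴸK̇Γ, 𝓘ᴸK̇𝓘]]` (pure block algebra, any field).
* §2 entry jets at a non-degenerate point: `hasDerivAt_flucCov_entry` (`−ΓK̇Γ`), `hasDerivAt_minOp_entry` (`−ΓK̇𝓘`), `hasDerivAt_minOpL_entry` (`−𝓘ᴸK̇Γ`),
  **`hasDerivAt_effForm_entry`** (`+𝓘ᴸK̇𝓘`); matrix-curve forms `hasDerivAt_flucCov` ∕ `hasDerivAt_minOp` ∕ `hasDerivAt_minOpL` ∕ **`hasDerivAt_effForm`**.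
* §3 **`hasDerivAt_effFormJet`** — the second jet: `u ↦ 𝓘ᴸ(u)K̇(u)𝓘(u)` has derivative `−𝓘ᴸK̇ΓK̇𝓘 + 𝓘ᴸK̈𝓘 − 𝓘ᴸK̇ΓK̇𝓘` at `t`; `eventually_hasDerivAt_effForm` (the first
  jet near a non-degenerate point); `hasDerivAt_toBlocks₁₁` (corner of a matrix curve).
* §4 **`secondVar_nestedStepLaw_explicit`** — `NestedDressingHessian.secondVar_nestedStepLaw` with the block curve `E(u) := (effForm (Π_nestᵀH(u)Π_nest) [Q₁;τ₁])₁₁` and its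
  two jets WRITTEN OUT: the second variation of the nested one shot = the literal-dressed fine one + the block one AT THE EXPLICIT COARSE TABLES.
Provenance: road FP OWNER b2b-balaban-beta-d1-p3 gen 15 (prover-b2b-balaban-beta-d1-p3-g15-0), 2026-08-21; rows SDF-EXACT (model) ∕ (J-S)(J-W) targets.  Orientation only
(nothing quoted is load-bearing): the first-jet statement is the envelope theorem for the tree-level effective action, cf. [Balaban1985BackgroundPropagators] §3
(3.126)–(3.148) for the objects; this file's content is textbook calculus.
-/

noncomputable section

namespace Summit.QuantumFields.BalabanUV.Beta.FP.EffectiveFormJets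

open Matrix Filter Finset
open scoped Topology
open Literature.MathematicalPhysics.QuantumFieldTheory.Balaban1983to89.Beta.Composition (kkt)
open Literature.MathematicalPhysics.QuantumFieldTheory.Balaban1983to89.Beta.CompositionSingular
  (effForm minOp minOpL flucCov kktInv_eq_fromBlocks kkt_eq_fromBlocks)
open Literature.Analysis.Calculus (eventually_det_ne_zero)
open Summit.QuantumFields.BalabanUV.Beta.D1BFx.LogDetSecondVariation (secondVar hasDerivAt_inv_entry)
open Summit.QuantumFields.BalabanUV.Beta.D1BFx.SliceTransferModel (hasDerivAt_kkt hasDerivAt_matMul hasDerivAt_entry)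
open Summit.QuantumFields.BalabanUV.Beta.FP.NestedDressingStepLaw (det_kkt_nestedDressed_eq_fineDressed)
open Summit.QuantumFields.BalabanUV.Beta.FP.NestedDressingHessian (hasDerivAt_conj secondVar_nestedStepLaw)

/-! ## §1 Block algebra: the bordered inverse against a pure form jet -/

section Blocks

variable {𝕜 : Type*} [Field 𝕜]
variable {ν μ : Type*} [Fintype ν] [Fintype μ] [DecidableEq ν] [DecidableEq μ]

/-- [folklore] **`𝕂⁻¹·kkt K̇ 0·𝕂⁻¹ = [[ΓK̇Γ, ΓK̇𝓘],[𝓘ᴸK̇Γ, 𝓘ᴸK̇𝓘]]`** (`𝕂 = kkt H C`; `Γ`, `𝓘`, `𝓘ᴸ` its three blocks; no invertibility needed — both sides are written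
with the same `(kkt H C)⁻¹`). -/
theorem kktInv_mul_kktZero_mul_kktInv (H K₁ : Matrix ν ν 𝕜) (C : Matrix μ ν 𝕜) :
    (kkt H C)⁻¹ * kkt K₁ (0 : Matrix μ ν 𝕜) * (kkt H C)⁻¹ =
      fromBlocks (flucCov H C * K₁ * flucCov H C) (flucCov H C * K₁ * minOp H C)
        (minOpL H C * K₁ * flucCov H C) (minOpL H C * K₁ * minOp H C) := by
  rw [kktInv_eq_fromBlocks, kkt_eq_fromBlocks K₁, Matrix.transpose_zero, fromBlocks_multiply, fromBlocks_multiply]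
  simp only [Matrix.mul_zero, Matrix.zero_mul, add_zero]

end Blocks

/-! ## §2 Entry jets of the four blocks at a non-degenerate point -/

section EntryJets

variable {ν μ : Type*} [Fintype ν] [Fintype μ] [DecidableEq ν] [DecidableEq μ]
variable {K : ℝ → ν → ν → ℝ} {K₁ : Matrix ν ν ℝ} {C : Matrix μ ν ℝ} {t : ℝ}

omit [DecidableEq ν] [DecidableEq μ] in
/-- [folklore] The bordered curve `u ↦ kkt K(u) C` (static constraints) has derivative `kkt K̇ 0`. -/
theorem hasDerivAt_kkt_static (C : Matrix μ ν ℝ) (hK : HasDerivAt K (Matrix.of.symm K₁) t) :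
    HasDerivAt (fun u => Matrix.of.symm (kkt (Matrix.of (K u)) C)) (Matrix.of.symm (kkt K₁ (0 : Matrix μ ν ℝ))) t := by
  have h0 : HasDerivAt (fun _ : ℝ => Matrix.of.symm C) (Matrix.of.symm (0 : Matrix μ ν ℝ)) t := by
    have h := hasDerivAt_const t (Matrix.of.symm C)
    exact h
  exact hasDerivAt_kkt (Q := fun _ => Matrix.of.symm C) hK h0

/-- [folklore] Entry derivative of the bordered inverse: `((𝕂⁻¹)ₖₗ)˙ = −(𝕂⁻¹·kkt K̇ 0·𝕂⁻¹)ₖₗ`. -/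
theorem hasDerivAt_kktInv_entry (hK : HasDerivAt K (Matrix.of.symm K₁) t) (hdet : (kkt (Matrix.of (K t)) C).det ≠ 0)
    (k l : ν ⊕ μ) :
    HasDerivAt (fun u => (kkt (Matrix.of (K u)) C)⁻¹ k l)
      (-((kkt (Matrix.of (K t)) C)⁻¹ * kkt K₁ (0 : Matrix μ ν ℝ) * (kkt (Matrix.of (K t)) C)⁻¹) k l) t :=
  hasDerivAt_inv_entry (A := fun u => Matrix.of.symm (kkt (Matrix.of (K u)) C)) (A₁ := kkt K₁ (0 : Matrix μ ν ℝ))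
    (hasDerivAt_kkt_static C hK) hdet k l

/-- [folklore] **`Γ̇ = −ΓK̇Γ`**, entrywise. -/
theorem hasDerivAt_flucCov_entry (hK : HasDerivAt K (Matrix.of.symm K₁) t) (hdet : (kkt (Matrix.of (K t)) C).det ≠ 0) (i j : ν) :
    HasDerivAt (fun u => flucCov (Matrix.of (K u)) C i j)
      (-(flucCov (Matrix.of (K t)) C * K₁ * flucCov (Matrix.of (K t)) C) i j) t := by
  refine (hasDerivAt_kktInv_entry hK hdet (Sum.inl i) (Sum.inl j)).congr_deriv ?_
  simp only [kktInv_mul_kktZero_mul_kktInv, fromBlocks_apply₁₁]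

/-- [folklore] **`𝓘̇ = −ΓK̇𝓘`**, entrywise. -/
theorem hasDerivAt_minOp_entry (hK : HasDerivAt K (Matrix.of.symm K₁) t) (hdet : (kkt (Matrix.of (K t)) C).det ≠ 0) (i : ν) (j : μ) :
    HasDerivAt (fun u => minOp (Matrix.of (K u)) C i j)
      (-(flucCov (Matrix.of (K t)) C * K₁ * minOp (Matrix.of (K t)) C) i j) t := by
  refine (hasDerivAt_kktInv_entry hK hdet (Sum.inl i) (Sum.inr j)).congr_deriv ?_
  simp only [kktInv_mul_kktZero_mul_kktInv, fromBlocks_apply₁₂]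

/-- [folklore] **`𝓘̇ᴸ = −𝓘ᴸK̇Γ`**, entrywise. -/
theorem hasDerivAt_minOpL_entry (hK : HasDerivAt K (Matrix.of.symm K₁) t) (hdet : (kkt (Matrix.of (K t)) C).det ≠ 0) (i : μ) (j : ν) :
    HasDerivAt (fun u => minOpL (Matrix.of (K u)) C i j)
      (-(minOpL (Matrix.of (K t)) C * K₁ * flucCov (Matrix.of (K t)) C) i j) t := by
  refine (hasDerivAt_kktInv_entry hK hdet (Sum.inr i) (Sum.inl j)).congr_deriv ?_
  simp only [kktInv_mul_kktZero_mul_kktInv, fromBlocks_apply₂₁]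

/-- [folklore] **THE ENVELOPE THEOREM, entrywise: `𝔊̇ = 𝓘ᴸK̇𝓘`** — the first jet of the effective form `effForm = −(𝕂⁻¹)₂₂` is the sandwich of the form's jet
by the minimiser operator and its left companion; NO fluctuation-response term at first order. -/
theorem hasDerivAt_effForm_entry (hK : HasDerivAt K (Matrix.of.symm K₁) t) (hdet : (kkt (Matrix.of (K t)) C).det ≠ 0) (i j : μ) :
    HasDerivAt (fun u => effForm (Matrix.of (K u)) C i j)
      ((minOpL (Matrix.of (K t)) C * K₁ * minOp (Matrix.of (K t)) C) i j) t := by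
  have h := (hasDerivAt_kktInv_entry hK hdet (Sum.inr i) (Sum.inr j)).neg
  have h' : HasDerivAt (fun u => effForm (Matrix.of (K u)) C i j)
      (-(-((kkt (Matrix.of (K t)) C)⁻¹ * kkt K₁ (0 : Matrix μ ν ℝ) * (kkt (Matrix.of (K t)) C)⁻¹) (Sum.inr i) (Sum.inr j))) t :=
    h.congr_of_eventuallyEq (Eventually.of_forall fun u => rfl)
  refine h'.congr_deriv ?_
  simp only [kktInv_mul_kktZero_mul_kktInv, fromBlocks_apply₂₂, neg_neg]

/-- [folklore] `Γ̇ = −ΓK̇Γ` as a matrix curve. -/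
theorem hasDerivAt_flucCov (hK : HasDerivAt K (Matrix.of.symm K₁) t) (hdet : (kkt (Matrix.of (K t)) C).det ≠ 0) :
    HasDerivAt (fun u => Matrix.of.symm (flucCov (Matrix.of (K u)) C))
      (Matrix.of.symm (-(flucCov (Matrix.of (K t)) C * K₁ * flucCov (Matrix.of (K t)) C))) t :=
  hasDerivAt_pi.2 fun i => hasDerivAt_pi.2 fun j => hasDerivAt_flucCov_entry hK hdet i j

/-- [folklore] `𝓘̇ = −ΓK̇𝓘` as a matrix curve. -/
theorem hasDerivAt_minOp (hK : HasDerivAt K (Matrix.of.symm K₁) t) (hdet : (kkt (Matrix.of (K t)) C).det ≠ 0) :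
    HasDerivAt (fun u => Matrix.of.symm (minOp (Matrix.of (K u)) C))
      (Matrix.of.symm (-(flucCov (Matrix.of (K t)) C * K₁ * minOp (Matrix.of (K t)) C))) t :=
  hasDerivAt_pi.2 fun i => hasDerivAt_pi.2 fun j => hasDerivAt_minOp_entry hK hdet i j

/-- [folklore] `𝓘̇ᴸ = −𝓘ᴸK̇Γ` as a matrix curve. -/
theorem hasDerivAt_minOpL (hK : HasDerivAt K (Matrix.of.symm K₁) t) (hdet : (kkt (Matrix.of (K t)) C).det ≠ 0) :
    HasDerivAt (fun u => Matrix.of.symm (minOpL (Matrix.of (K u)) C))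
      (Matrix.of.symm (-(minOpL (Matrix.of (K t)) C * K₁ * flucCov (Matrix.of (K t)) C))) t :=
  hasDerivAt_pi.2 fun i => hasDerivAt_pi.2 fun j => hasDerivAt_minOpL_entry hK hdet i j

/-- [folklore] **`𝔊̇ = 𝓘ᴸK̇𝓘`** as a matrix curve (the envelope theorem). -/
theorem hasDerivAt_effForm (hK : HasDerivAt K (Matrix.of.symm K₁) t) (hdet : (kkt (Matrix.of (K t)) C).det ≠ 0) :
    HasDerivAt (fun u => Matrix.of.symm (effForm (Matrix.of (K u)) C))
      (Matrix.of.symm (minOpL (Matrix.of (K t)) C * K₁ * minOp (Matrix.of (K t)) C)) t :=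
  hasDerivAt_pi.2 fun i => hasDerivAt_pi.2 fun j => hasDerivAt_effForm_entry hK hdet i j

end EntryJets

/-! ## §3 The second jet of the effective form; the first jet near a non-degenerate point; corners of curves -/

section SecondJet

variable {ν μ : Type*} [Fintype ν] [Fintype μ] [DecidableEq ν] [DecidableEq μ]

/-- [folklore] **THE SECOND JET OF THE EFFECTIVE FORM**: if the form curve `K` has first jets `K₁ u` near... (here: AT `t`, `K₁ t`) and `K₁` has derivative `K₂` at `t`,
and the bordered system is non-degenerate at `t`, then the envelope curve `u ↦ 𝓘ᴸ(u)·K₁(u)·𝓘(u)` has derivative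
`−𝓘ᴸK̇ΓK̇𝓘 + 𝓘ᴸK̈𝓘 − 𝓘ᴸK̇ΓK̇𝓘` at `t` (`K̇ = K₁ t`, `K̈ = K₂`; blocks of `(K(t), C)`): the fluctuation RESPONSE word appears twice, once from each minimiser leg. -/
theorem hasDerivAt_effFormJet {K K₁ : ℝ → ν → ν → ℝ} {K₂ : Matrix ν ν ℝ} {C : Matrix μ ν ℝ} {t : ℝ}
    (hK : HasDerivAt K (K₁ t) t) (hK₁ : HasDerivAt K₁ (Matrix.of.symm K₂) t) (hdet : (kkt (Matrix.of (K t)) C).det ≠ 0) :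
    HasDerivAt (fun u => Matrix.of.symm (minOpL (Matrix.of (K u)) C * Matrix.of (K₁ u) * minOp (Matrix.of (K u)) C))
      (Matrix.of.symm
        (-(minOpL (Matrix.of (K t)) C * Matrix.of (K₁ t) * flucCov (Matrix.of (K t)) C) * Matrix.of (K₁ t) * minOp (Matrix.of (K t)) C
          + minOpL (Matrix.of (K t)) C * K₂ * minOp (Matrix.of (K t)) C
          + minOpL (Matrix.of (K t)) C * Matrix.of (K₁ t) * -(flucCov (Matrix.of (K t)) C * Matrix.of (K₁ t) * minOp (Matrix.of (K t)) C))) t := by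
  have hK' : HasDerivAt K (Matrix.of.symm (Matrix.of (K₁ t))) t := hK
  have hL := hasDerivAt_minOpL (C := C) hK' hdet
  have hI := hasDerivAt_minOp (C := C) hK' hdet
  have hLK := hasDerivAt_matMul (X := fun u => Matrix.of.symm (minOpL (Matrix.of (K u)) C)) (Y := K₁) hL hK₁
  have h := hasDerivAt_matMul (X := fun u => Matrix.of.symm (Matrix.of (Matrix.of.symm (minOpL (Matrix.of (K u)) C)) * Matrix.of (K₁ u)))
    (Y := fun u => Matrix.of.symm (minOp (Matrix.of (K u)) C)) hLK hI
  simpa only [Equiv.apply_symm_apply, Matrix.add_mul] using h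

/-- [folklore] **THE FIRST JET NEAR A NON-DEGENERATE POINT**: if `K` has first jets `K₁ u` at every `u` near `t` and the bordered system is non-degenerate at `t`, then at
every `u` near `t` the effective form curve has derivative `𝓘ᴸ(u)·K₁(u)·𝓘(u)` (non-degeneracy persists, `eventually_det_ne_zero`). -/
theorem eventually_hasDerivAt_effForm {K K₁ : ℝ → ν → ν → ℝ} {C : Matrix μ ν ℝ} {t : ℝ}
    (hK : ∀ᶠ u in 𝓝 t, HasDerivAt K (K₁ u) u) (hdet : (kkt (Matrix.of (K t)) C).det ≠ 0) :
    ∀ᶠ u in 𝓝 t, HasDerivAt (fun v => Matrix.of.symm (effForm (Matrix.of (K v)) C))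
      ((fun u => Matrix.of.symm (minOpL (Matrix.of (K u)) C * Matrix.of (K₁ u) * minOp (Matrix.of (K u)) C)) u) u := by
  have hKt : HasDerivAt K (Matrix.of.symm (Matrix.of (K₁ t))) t := hK.self_of_nhds
  have hne : ∀ᶠ u in 𝓝 t, (Matrix.of (Matrix.of.symm (kkt (Matrix.of (K u)) C))).det ≠ 0 :=
    eventually_det_ne_zero (hasDerivAt_kkt_static C hKt).hasFDerivAt hdet
  filter_upwards [hK, hne] with u huK hune
  have huK' : HasDerivAt K (Matrix.of.symm (Matrix.of (K₁ u))) u := huK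
  exact hasDerivAt_effForm huK' hune

omit [DecidableEq ν] [DecidableEq μ] in
/-- [folklore] The `₁₁` corner of a differentiable matrix curve is differentiable, with the corner of the derivative. -/
theorem hasDerivAt_toBlocks₁₁ {X : ℝ → (μ ⊕ ν) → (μ ⊕ ν) → ℝ} {X' : Matrix (μ ⊕ ν) (μ ⊕ ν) ℝ} {t : ℝ} (hX : HasDerivAt X (Matrix.of.symm X') t) :
    HasDerivAt (fun u => Matrix.of.symm (Matrix.of (X u)).toBlocks₁₁) (Matrix.of.symm X'.toBlocks₁₁) t :=
  hasDerivAt_pi.2 fun i => hasDerivAt_pi.2 fun j => hasDerivAt_entry hX (Sum.inl i) (Sum.inl j)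

end SecondJet

/-! ## §4 The nested step law's second variation with the block curve WRITTEN OUT -/

section Explicit

variable {ν μ κ ρ₁ ρ₂ : Type*} [Fintype ν] [Fintype μ] [Fintype κ] [Fintype ρ₁] [Fintype ρ₂]
  [DecidableEq ν] [DecidableEq μ] [DecidableEq κ] [DecidableEq ρ₁] [DecidableEq ρ₂]

/-- [folklore] **THE SECOND VARIATION OF THE NESTED STEP LAW AT THE EXPLICIT COARSE TABLES** (row SDF-EXACT-2 at MODEL level).  Static data as in
`NestedDressingStepLaw.det_kkt_comp_nestedDressed`, the two dressings NAMED (`hPN`, `hP1`, instantiate with `rfl`); a `C²` form curve `u ↦ H(u)` with jets `H₁ u` near `0`,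
`H₂` at `0`, values `H₀ = H(0)`, `K₁ = H₁(0)`; the nested fine system `(K♮ := Π_nestᵀH₀Π_nest, [Q₁;τ₁])` with blocks `Γ♮ = flucCov`, `𝓘♮ = minOp`, `𝓘♮ᴸ = minOpL` (NAMED by
`rfl`-hypotheses); non-degeneracy of the ONE-STEP-dressed fine system and of the block system at `0`.  CONCLUSION: `NestedDressingHessian.secondVar_nestedStepLaw` with
the block curve `E(u) := (effForm (Π_nestᵀH(u)Π_nest) [Q₁;τ₁])₁₁` and ITS OWN jets:
`E₀ = (effForm K♮ [Q₁;τ₁])₁₁`,  `Ė = (𝓘♮ᴸ·K̇♮·𝓘♮)₁₁`,  `Ë = (−𝓘♮ᴸK̇♮Γ♮K̇♮𝓘♮ + 𝓘♮ᴸK̈♮𝓘♮ + 𝓘♮ᴸK̇♮(−Γ♮K̇♮𝓘♮))₁₁`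
(`K̇♮ = Π_nestᵀK₁Π_nest`, `K̈♮ = Π_nestᵀH₂Π_nest`) — THE COARSE TABLES OF THE EXACT STEP LAW: the block step reads the minimiser sandwich of the dressed first jet, and
at second order the minimiser sandwich of the dressed second jet MINUS TWICE the fluctuation-response word. -/
theorem secondVar_nestedStepLaw_explicit (Q₁ : Matrix μ ν ℝ) (S₁ : Matrix ρ₁ ν ℝ) (Sc : Matrix ρ₂ μ ℝ)
    (W₁ : Matrix ν ρ₁ ℝ) (W₂ : Matrix ν ρ₂ ℝ) (hQW₁ : Q₁ * W₁ = 0) (hT : IsUnit (S₁ * W₁).det) (hTc : IsUnit (Sc * (Q₁ * W₂)).det)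
    (Qr : Matrix ν μ ℝ) (hQr : Q₁ * Qr = 1)
    (τ₁ : Matrix ρ₁ ν ℝ) (hτ : IsUnit (τ₁ * W₁).det) (Q₂ : Matrix κ μ ℝ) (hQQW₂ : Q₂ * (Q₁ * W₂) = 0) (τ₂ : Matrix ρ₂ μ ℝ)
    (hτc : IsUnit (τ₂ * (Q₁ * W₂)).det) (P : Matrix (ρ₂ ⊕ ρ₁) ν ℝ) (hP : IsUnit (P * fromCols W₂ W₁).det)
    -- the two dressings, NAMED (instantiate with `rfl`)
    {PN P1 : Matrix ν ν ℝ} (hPN : PN = 1 - fromCols W₂ W₁ * (fromRows (Sc * Q₁) S₁ * fromCols W₂ W₁)⁻¹ * fromRows (Sc * Q₁) S₁)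
    (hP1 : P1 = 1 - W₁ * (S₁ * W₁)⁻¹ * S₁)
    -- the form curve and its jets at `0`
    {H H₁ : ℝ → ν → ν → ℝ} {H₀ K₁ H₂ : Matrix ν ν ℝ}
    (hH : ∀ᶠ u in 𝓝 (0 : ℝ), HasDerivAt H (H₁ u) u) (hH₁ : HasDerivAt H₁ (Matrix.of.symm H₂) 0)
    (hH0 : Matrix.of (H 0) = H₀) (hH₁0 : Matrix.of (H₁ 0) = K₁)
    -- the three blocks of the nested fine system at `0`, NAMED (instantiate with `rfl`)
    {Γn : Matrix ν ν ℝ} {In : Matrix ν (μ ⊕ ρ₁) ℝ} {Ln : Matrix (μ ⊕ ρ₁) ν ℝ}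
    (hΓn : Γn = flucCov (PNᵀ * H₀ * PN) (fromRows Q₁ τ₁)) (hIn : In = minOp (PNᵀ * H₀ * PN) (fromRows Q₁ τ₁))
    (hLn : Ln = minOpL (PNᵀ * H₀ * PN) (fromRows Q₁ τ₁))
    -- non-degeneracy at `0`
    (h1 : (kkt (P1ᵀ * H₀ * P1) (fromRows Q₁ τ₁)).det ≠ 0)
    (h2 : (kkt (effForm (PNᵀ * H₀ * PN) (fromRows Q₁ τ₁)).toBlocks₁₁ (fromRows Q₂ τ₂)).det ≠ 0) :
    secondVar (kkt (PNᵀ * H₀ * PN) (fromRows (Q₂ * Q₁) P)) (kkt (PNᵀ * K₁ * PN) (0 : Matrix (κ ⊕ (ρ₂ ⊕ ρ₁)) ν ℝ))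
        (kkt (PNᵀ * H₂ * PN) (0 : Matrix (κ ⊕ (ρ₂ ⊕ ρ₁)) ν ℝ))
      = secondVar (kkt (P1ᵀ * H₀ * P1) (fromRows Q₁ τ₁)) (kkt (P1ᵀ * K₁ * P1) (0 : Matrix (μ ⊕ ρ₁) ν ℝ))
          (kkt (P1ᵀ * H₂ * P1) (0 : Matrix (μ ⊕ ρ₁) ν ℝ))
        + secondVar (kkt (effForm (PNᵀ * H₀ * PN) (fromRows Q₁ τ₁)).toBlocks₁₁ (fromRows Q₂ τ₂))
            (kkt (Ln * (PNᵀ * K₁ * PN) * In).toBlocks₁₁ (0 : Matrix (κ ⊕ ρ₂) μ ℝ))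
            (kkt (-(Ln * (PNᵀ * K₁ * PN) * Γn) * (PNᵀ * K₁ * PN) * In + Ln * (PNᵀ * H₂ * PN) * In
                  + Ln * (PNᵀ * K₁ * PN) * -(Γn * (PNᵀ * K₁ * PN) * In)).toBlocks₁₁ (0 : Matrix (κ ⊕ ρ₂) μ ℝ)) := by
  subst hH0 hH₁0 hΓn hIn hLn
  -- the nested fine form curve and its jets
  set Kc : ℝ → ν → ν → ℝ := fun u => Matrix.of.symm (PNᵀ * Matrix.of (H u) * PN) with hKc
  set Kc₁ : ℝ → ν → ν → ℝ := fun u => Matrix.of.symm (PNᵀ * Matrix.of (H₁ u) * PN) with hKc₁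
  have hH' : ∀ᶠ u in 𝓝 (0 : ℝ), HasDerivAt H (Matrix.of.symm (Matrix.of (H₁ u))) u := hH
  have hKcd : ∀ᶠ u in 𝓝 (0 : ℝ), HasDerivAt Kc (Kc₁ u) u := by
    filter_upwards [hH'] with u huH
    exact hasDerivAt_conj PNᵀ PN huH
  have hKc₁d : HasDerivAt Kc₁ (Matrix.of.symm (PNᵀ * H₂ * PN)) 0 := hasDerivAt_conj PNᵀ PN hH₁
  -- non-degeneracy of the nested fine system at `0` (= that of the one-step-dressed one)
  have h1n : (kkt (Matrix.of (Kc 0)) (fromRows Q₁ τ₁)).det ≠ 0 := by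
    show (kkt (PNᵀ * Matrix.of (H 0) * PN) (fromRows Q₁ τ₁)).det ≠ 0
    rw [hPN, det_kkt_nestedDressed_eq_fineDressed (Matrix.of (H 0)) Q₁ τ₁ S₁ Sc W₁ W₂ hQW₁ hT hTc Qr hQr, ← hP1]
    exact h1
  -- the block curve `E` and its jets
  have hEd : ∀ᶠ u in 𝓝 (0 : ℝ), HasDerivAt (fun v => Matrix.of.symm (effForm (Matrix.of (Kc v)) (fromRows Q₁ τ₁)).toBlocks₁₁)
      ((fun u => Matrix.of.symm (minOpL (Matrix.of (Kc u)) (fromRows Q₁ τ₁) * Matrix.of (Kc₁ u) *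
        minOp (Matrix.of (Kc u)) (fromRows Q₁ τ₁)).toBlocks₁₁) u) u := by
    filter_upwards [eventually_hasDerivAt_effForm (C := fromRows Q₁ τ₁) hKcd h1n] with u hu
    exact hasDerivAt_toBlocks₁₁ hu
  have hE₁d : HasDerivAt (fun u => Matrix.of.symm (minOpL (Matrix.of (Kc u)) (fromRows Q₁ τ₁) * Matrix.of (Kc₁ u) *
        minOp (Matrix.of (Kc u)) (fromRows Q₁ τ₁)).toBlocks₁₁)
      (Matrix.of.symm
        (-(minOpL (Matrix.of (Kc 0)) (fromRows Q₁ τ₁) * Matrix.of (Kc₁ 0) * flucCov (Matrix.of (Kc 0)) (fromRows Q₁ τ₁)) * Matrix.of (Kc₁ 0) *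
              minOp (Matrix.of (Kc 0)) (fromRows Q₁ τ₁)
          + minOpL (Matrix.of (Kc 0)) (fromRows Q₁ τ₁) * (PNᵀ * H₂ * PN) * minOp (Matrix.of (Kc 0)) (fromRows Q₁ τ₁)
          + minOpL (Matrix.of (Kc 0)) (fromRows Q₁ τ₁) * Matrix.of (Kc₁ 0) *
              -(flucCov (Matrix.of (Kc 0)) (fromRows Q₁ τ₁) * Matrix.of (Kc₁ 0) * minOp (Matrix.of (Kc 0)) (fromRows Q₁ τ₁))).toBlocks₁₁) 0 :=
    hasDerivAt_toBlocks₁₁ (hasDerivAt_effFormJet (C := fromRows Q₁ τ₁) hKcd.self_of_nhds hKc₁d h1n)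
  have hEeq : ∀ᶠ u in 𝓝 (0 : ℝ), Matrix.of ((fun v => Matrix.of.symm (effForm (Matrix.of (Kc v)) (fromRows Q₁ τ₁)).toBlocks₁₁) u) =
      (effForm (PNᵀ * Matrix.of (H u) * PN) (fromRows Q₁ τ₁)).toBlocks₁₁ :=
    Eventually.of_forall fun u => rfl
  have h1' : (kkt (P1ᵀ * Matrix.of (H 0) * P1) (fromRows Q₁ τ₁)).det ≠ 0 := h1
  have h2' : (kkt (Matrix.of ((fun v => Matrix.of.symm (effForm (Matrix.of (Kc v)) (fromRows Q₁ τ₁)).toBlocks₁₁) 0)) (fromRows Q₂ τ₂)).det ≠ 0 := h2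
  have h := secondVar_nestedStepLaw Q₁ S₁ Sc W₁ W₂ hQW₁ hT hTc Qr hQr τ₁ hτ Q₂ hQQW₂ τ₂ hτc P hP hH hH₁ hEd hE₁d
  subst hPN hP1
  exact h hEeq h1' h2'

end Explicit

end Summit.QuantumFields.BalabanUV.Beta.FP.EffectiveFormJets

end
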